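import Summits.CriticalPhenomena.SAWScalingLimit.Theorems.SAWLeftRightFKGFKGToTraversalBoundSlotCombinatorics
import Summits.CriticalPhenomena.SAWScalingLimit.Theorems.SAWLeftRightFKGFKGToTraversalBoundDomainMarkov
import HarnessLib

/-!
# Slot law, part 3: the doubly-slit hung carrier and the engine (chart r4 §1, S2/S3)

Crux `SAWLeftRightFKG.FKGToTraversalBound` (stmt-CriticalPhenomena-1878), line `slit-necklace` (reshape r4),
stub `stub_slotLaw : SlotLaw` (lead prover-line-stmt-CriticalPhenomena-1878-c5-0), chart
`Cruxes/FKGToTraversalBound/Lines/slit-necklace-chart-r4.md` §1.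

The middle of the `J`-th far-tip piece, given its exterior, is the critical chord of the hung carrier
`Ω' = dom C'' δ` presented by `HungPresentation` applied to `(dom C δ)_δ = D_δ ∖ S` (tame presentation) and the
finite set `K` = spine ∪ prefix ∪ suffix vertices.  This file supplies the plumbing between the three graphs
`D_δ`, `(dom C δ)_δ`, `(dom C'' δ)_δ` and runs the engine on `Ω'`:

* `keep_adj_iff` — the `Keep`-sets of the hung presentation (walks of `(dom C δ)_δ` avoiding `K`) and of the
  bead identity (walks of `D_δ` avoiding `K`) agree, because `K ⊇ S` and the two graphs agree off `S`;
* `edges_mem_edgeSet_keep` — a walk of `D_δ` into the target avoiding `K` is a walk of `Ω'_δ`;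
* `slotK_attached` — every site of `K` is attached to the presentation walk `C` through `K ∪ C.support`
  (prefix sites back along the chord to `a₀ ∈ Ka`, suffix sites forward to `b₀ ∈ Kb`, then the spine's own
  attachment), the hypothesis of `HungPresentation`;
* `law_slotMiddle_le` — **S3**: `Ω'` is an r2 carrier with both far tips trace-adjacent (`p τ ∼ p (τ-1) ∈ K`,
  `p τ' ∼ p (τ'+1) ∈ K`), the far-tip witness is a chord of `Ω'` with fewer than `2 (n₀ + 1)` traversals of
  the sub-shell (`ShellIteration.exists_sepIndexTraversals_of_hasTraversals_toCurve`, p115507), so the engine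
  `UniformSubshellTight` (instantiated at allowance `2 n₀ + 1`) bounds the law of `n` index windows of the
  middle across `D(y; ρ, R)` (`hasTraversals_of_hasSepWindows`, p129943) by `ε`.

All statements folklore; no literature fact; axioms are the standard three.
-/

noncomputable section

open MeasureTheory Filter Topology Set Metric
open scoped NNReal ENNReal
open Literature.Probability.LatticeModels
open Literature.Probability.RandomPlanarGeometry
open Literature.Probability.RandomPlanarGeometry.SAW
open Summit.CriticalPhenomena.SAWScalingLimit.Theorems.FKGToTraversalBound.Negative (dom)

namespace Summit.CriticalPhenomena.SAWScalingLimit.Theorems.FKGToTraversalBound.SlitNecklace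

section Keep

variable {Ω Ω' : Set ℂ} {δ : ℝ}

/-- **The two `Keep`-sets agree.**  If `(dom C δ)_δ` is `Ω_δ` minus the defect sites `S ⊆ K` (tame
presentation) and `(dom C' δ)_δ` is `(dom C δ)_δ` restricted to `Keep(b, K)` read with walks of `(dom C δ)_δ`
(hung presentation), then `(dom C' δ)_δ` is `Ω_δ` restricted to `Keep(b, K)` read with walks of `Ω_δ` (the
form `necklace_beadIdentity` consumes): a walk of `Ω_δ` avoiding `K ⊇ S` is a walk of `(dom C δ)_δ`
(`Walk.transfer`), and conversely (`Walk.mapLe`). [folklore] -/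
theorem keep_adj_iff {c c' b : Site 2} {C : (zdGraph 2).Walk c c} {C' : (zdGraph 2).Walk c' c'}
    {S : Finset (Site 2)} {K : Set (Site 2)}
    (hS : ∀ x y, (discreteDomainGraph (dom C δ) δ).Adj x y ↔
      ((discreteDomainGraph Ω δ).Adj x y ∧ x ∉ S ∧ y ∉ S))
    (hSK : ∀ z ∈ S, z ∈ K)
    (hC' : ∀ x y, (discreteDomainGraph (dom C' δ) δ).Adj x y ↔
      ((discreteDomainGraph (dom C δ) δ).Adj x y ∧
        (∃ q : (discreteDomainGraph (dom C δ) δ).Walk x b, ∀ v ∈ q.support, v ∉ K) ∧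
        (∃ q : (discreteDomainGraph (dom C δ) δ).Walk y b, ∀ v ∈ q.support, v ∉ K))) :
    ∀ x y, (discreteDomainGraph (dom C' δ) δ).Adj x y ↔
      ((discreteDomainGraph Ω δ).Adj x y ∧
        (∃ q : (discreteDomainGraph Ω δ).Walk x b, ∀ v ∈ q.support, v ∉ K) ∧
        (∃ q : (discreteDomainGraph Ω δ).Walk y b, ∀ v ∈ q.support, v ∉ K)) := by
  have hle : discreteDomainGraph (dom C δ) δ ≤ discreteDomainGraph Ω δ := fun x y h => ((hS x y).1 h).1
  have hkeep : ∀ x, (∃ q : (discreteDomainGraph (dom C δ) δ).Walk x b, ∀ v ∈ q.support, v ∉ K) ↔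
      (∃ q : (discreteDomainGraph Ω δ).Walk x b, ∀ v ∈ q.support, v ∉ K) := by
    intro x
    constructor
    · rintro ⟨q, hq⟩
      exact ⟨q.mapLe hle, by rw [SimpleGraph.Walk.support_mapLe_eq_support]; exact hq⟩
    · rintro ⟨q, hq⟩
      have hedges := ExcursionDomination.edges_mem_edgeSet_of_support
        (G := discreteDomainGraph Ω δ) (G' := discreteDomainGraph (dom C δ) δ) (K := (↑S : Set (Site 2)))
        (fun x y h hx hy => (hS x y).2 ⟨h, hx, hy⟩) q (fun v hv hvS => hq v hv (hSK v hvS))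
      exact ⟨q.transfer _ hedges, by rw [SimpleGraph.Walk.support_transfer]; exact hq⟩
  intro x y
  rw [hC', hS, hkeep, hkeep]
  constructor
  · rintro ⟨⟨h, -, -⟩, hx, hy⟩
    exact ⟨h, hx, hy⟩
  · rintro ⟨h, hx, hy⟩
    obtain ⟨qx, hqx⟩ := hx
    obtain ⟨qy, hqy⟩ := hy
    exact ⟨⟨h, fun hxS => hqx x qx.start_mem_support (hSK x hxS),
      fun hyS => hqy y qy.start_mem_support (hSK y hyS)⟩, ⟨qx, hqx⟩, ⟨qy, hqy⟩⟩

/-- A walk of `Ω_δ` into the target `b` avoiding `K` is a walk of the graph `Ω'_δ` = `Ω_δ` restricted to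
`Keep(b, K)`: each of its vertices reaches `b` off `K` along the rest of the walk. [folklore] -/
theorem edges_mem_edgeSet_keep {K : Set (Site 2)} {b : Site 2}
    (hadj : ∀ x y, (discreteDomainGraph Ω' δ).Adj x y ↔
      ((discreteDomainGraph Ω δ).Adj x y ∧
        (∃ q : (discreteDomainGraph Ω δ).Walk x b, ∀ v ∈ q.support, v ∉ K) ∧
        (∃ q : (discreteDomainGraph Ω δ).Walk y b, ∀ v ∈ q.support, v ∉ K))) :
    ∀ {x : Site 2} (q : (discreteDomainGraph Ω δ).Walk x b), (∀ v ∈ q.support, v ∉ K) →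
      ∀ e, e ∈ q.edges → e ∈ (discreteDomainGraph Ω' δ).edgeSet := by
  -- generalise the target to run the induction
  suffices h : ∀ {x y : Site 2} (q : (discreteDomainGraph Ω δ).Walk x y), y = b →
      (∀ v ∈ q.support, v ∉ K) → ∀ e, e ∈ q.edges → e ∈ (discreteDomainGraph Ω' δ).edgeSet by
    intro x q hq
    exact h q rfl hq
  intro x y q
  induction q with
  | nil => intro _ _ e he; simp at he
  | @cons x z y hxz q ih =>
    intro hy hs e he
    subst hy
    rw [SimpleGraph.Walk.edges_cons, List.mem_cons] at he
    rw [SimpleGraph.Walk.support_cons] at hs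
    have hsq : ∀ v ∈ q.support, v ∉ K := fun v hv => hs v (List.mem_cons_of_mem _ hv)
    rcases he with rfl | he
    · exact (SimpleGraph.mem_edgeSet _).2 ((hadj x z).2 ⟨hxz, ⟨SimpleGraph.Walk.cons hxz q, hs⟩, ⟨q, hsq⟩⟩)
    · exact ih rfl hsq e he

end Keep

section Attached

variable {Ω : Set ℂ} {δ : ℝ} {a₀ b₀ : Site 2}

/-- **The slot's obstacle set is attached.**  For a chord `p` of `Ω_δ` from `a₀ ∈ Σ` to `b₀ ∈ Σ` with the spine
`Σ` attached to `C` (every spine site joined to a vertex of `C` through `Σ ∪ C.support`), the finite set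
`K = Σ ∪ {p m : m < τ} ∪ {p m : τ' < m ≤ |p|}` is attached to `C` through `K ∪ C.support`: a prefix vertex
walks back along `p` to `a₀`, a suffix vertex forward along `p` to `b₀`, and then along the spine's attaching
walk (the hypothesis of `HungPresentation`). [folklore] -/
theorem slotK_attached {c : Site 2} {C : (zdGraph 2).Walk c c} {Sp K : Finset (Site 2)}
    {p : (discreteDomainGraph Ω δ).Walk a₀ b₀} {τ τ' : ℕ}
    (hatt : ∀ k ∈ Sp, ∃ (q : Site 2) (w : (zdGraph 2).Walk k q), q ∈ C.support ∧
      ∀ z ∈ w.support, z ∈ Sp ∨ z ∈ C.support)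
    (ha₀ : a₀ ∈ Sp) (hb₀ : b₀ ∈ Sp)
    (hK : ∀ z, z ∈ K ↔ z ∈ Sp ∨ ∃ m, m ≤ p.length ∧ (m < τ ∨ τ' < m) ∧ p.getVert m = z) :
    ∀ k ∈ K, ∃ (q : Site 2) (w : (zdGraph 2).Walk k q), q ∈ C.support ∧
      ∀ z ∈ w.support, z ∈ K ∨ z ∈ C.support := by
  have hzd : discreteDomainGraph Ω δ ≤ zdGraph 2 :=
    (discreteDomainGraph_le_meshGraph Ω δ).trans (meshGraph_le_zdGraph Ω δ)
  have hSpK : ∀ z ∈ Sp, z ∈ K := fun z hz => (hK z).2 (Or.inl hz)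
  -- extending a walk inside `K` that ends on the spine by the spine's attaching walk
  have hext : ∀ (k s : Site 2) (W : (zdGraph 2).Walk k s), s ∈ Sp → (∀ z ∈ W.support, z ∈ K) →
      ∃ (q : Site 2) (w : (zdGraph 2).Walk k q), q ∈ C.support ∧ ∀ z ∈ w.support, z ∈ K ∨ z ∈ C.support := by
    intro k s W hs hW
    obtain ⟨q, w, hq, hw⟩ := hatt s hs
    refine ⟨q, W.append w, hq, fun z hz => ?_⟩
    rcases (SimpleGraph.Walk.mem_support_append_iff _ _).1 hz with hz | hz
    · exact Or.inl (hW z hz)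
    · exact (hw z hz).imp_left (hSpK z)
  intro k hk
  rcases (hK k).1 hk with hkS | ⟨m, hmL, hm, rfl⟩
  · refine hext k k SimpleGraph.Walk.nil hkS fun z hz => ?_
    rw [SimpleGraph.Walk.support_nil, List.mem_singleton] at hz
    exact hz ▸ hk
  rcases hm with hm | hm
  · -- a prefix vertex: back along `p` to `a₀`
    refine hext _ a₀ ((p.take m).reverse.mapLe hzd) ha₀ fun z hz => ?_
    rw [SimpleGraph.Walk.support_mapLe_eq_support, SimpleGraph.Walk.support_reverse, List.mem_reverse,
      SimpleGraph.Walk.mem_support_iff_exists_getVert] at hz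
    obtain ⟨n, hn, hnl⟩ := hz
    rw [SimpleGraph.Walk.take_length] at hnl
    rw [SimpleGraph.Walk.take_getVert] at hn
    exact (hK z).2 (Or.inr ⟨min m n, by omega, Or.inl (by omega), hn⟩)
  · -- a suffix vertex: forward along `p` to `b₀`
    refine hext _ b₀ ((p.drop m).mapLe hzd) hb₀ fun z hz => ?_
    rw [SimpleGraph.Walk.support_mapLe_eq_support, SimpleGraph.Walk.mem_support_iff_exists_getVert] at hz
    obtain ⟨n, hn, hnl⟩ := hz
    rw [SimpleGraph.Walk.drop_length] at hnl
    rw [SimpleGraph.Walk.drop_getVert] at hn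
    exact (hK z).2 (Or.inr ⟨m + n, by omega, Or.inr (by omega), hn⟩)

end Attached

section Engine

variable {Ω : Set ℂ} {δ : ℝ} {a₀ b₀ : Site 2}

/-- **S3: the engine bounds the windows of the middle.**  Let `p` be a self-avoiding chord of `Ω_δ`,
`1 ≤ τ ≤ τ' < |p|`, `K ⊇ Sp` the spine together with the vertices of `p` of index `< τ` or `> τ'`, and let
`C''` be a closed lattice walk through `K` such that `(dom C'' δ)_δ` is `Ω_δ` restricted to `Keep(p τ', K)`.
Then `dom C'' δ` is an admissible carrier for the engine: `p τ ∼ p (τ - 1) ∈ C''.support`,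
`p τ' ∼ p (τ' + 1) ∈ C''.support`; a far-tip witness (`HasFarTipWitness`: a self-avoiding route `p τ → p τ'`
of `Ω_δ` avoiding `K` with fewer than `n₀ + 1` index windows across `D(y; s₁, s₂)`,
`(3ρ + R)/4 + δ ≤ s₁ < s₂ ≤ (ρ + 3R)/4 - δ`) is a chord of `(dom C'' δ)_δ` with fewer than `2 (n₀ + 1)`
traversals of the sub-shell `D(y; (3ρ+R)/4, (ρ+3R)/4)` (contrapositive of
`exists_sepIndexTraversals_of_hasTraversals_toCurve` at mesh step `δ`); so the engine's conclusion at allowance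
`2 n₀ + 1` and threshold `n` bounds the law of the chords of `dom C'' δ` from `p τ` to `p τ'` with `n` index
windows across `D(y; ρ, R)` (`hasTraversals_of_hasSepWindows`) by `ε`. [folklore] -/
theorem law_slotMiddle_le {Sp K : Set (Site 2)} {p : (discreteDomainGraph Ω δ).Walk a₀ b₀}
    {τ τ' n n₀ : ℕ} {c'' : Site 2} {C'' : (zdGraph 2).Walk c'' c''} {y : ℂ} {ρ R s₁ s₂ ε : ℝ}
    (hδ : 0 < δ) (hτ : 1 ≤ τ) (hττ' : τ ≤ τ') (hτ'L : τ' + 1 ≤ p.length)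
    (hK : ∀ z, z ∈ K ↔ z ∈ Sp ∨ ∃ m, m ≤ p.length ∧ (m < τ ∨ τ' < m) ∧ p.getVert m = z)
    (hKC : ∀ z ∈ K, z ∈ C''.support)
    (hadj : ∀ x' y', (discreteDomainGraph (dom C'' δ) δ).Adj x' y' ↔
      ((discreteDomainGraph Ω δ).Adj x' y' ∧
        (∃ q : (discreteDomainGraph Ω δ).Walk x' (p.getVert τ'), ∀ v ∈ q.support, v ∉ K) ∧
        (∃ q : (discreteDomainGraph Ω δ).Walk y' (p.getVert τ'), ∀ v ∈ q.support, v ∉ K)))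
    (hUST : ∀ (δ : ℝ) (c u v u' v' : Site 2) (C : (zdGraph 2).Walk c c),
      0 < δ → u' ∈ C.support → v' ∈ C.support → (zdGraph 2).Adj u u' → (zdGraph 2).Adj v v' →
      ∀ (x : ℂ) (ρ R : ℝ), δ ≤ ρ → 2 * ρ ≤ R →
        (∃ γ₀ : DomainSAW (dom C δ) δ u v,
          ¬ (polyline γ₀).HasTraversals (2 * n₀ + 1 + 1) x ((3 * ρ + R) / 4) ((ρ + 3 * R) / 4)) →
        law (dom C δ) δ u v {γ | (polyline γ).HasTraversals n x ρ R} ≤ ENNReal.ofReal ε)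
    (hρ : δ ≤ ρ) (hρR : 2 * ρ ≤ R) (hs₁ : (3 * ρ + R) / 4 + δ ≤ s₁) (hs₁₂ : s₁ < s₂)
    (hs₂ : s₂ ≤ (ρ + 3 * R) / 4 - δ)
    (hwit : HasFarTipWitness Ω δ Sp p τ τ' (n₀ + 1) y s₁ s₂) :
    law (dom C'' δ) δ (p.getVert τ) (p.getVert τ')
        {β' | HasSepWindows (meshPoint δ) β'.walk n 0 β'.walk.length y ρ R} ≤ ENNReal.ofReal ε := by
  have hzdΩ : discreteDomainGraph Ω δ ≤ zdGraph 2 :=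
    (discreteDomainGraph_le_meshGraph Ω δ).trans (meshGraph_le_zdGraph Ω δ)
  have hzdΩ' : discreteDomainGraph (dom C'' δ) δ ≤ zdGraph 2 :=
    (discreteDomainGraph_le_meshGraph _ δ).trans (meshGraph_le_zdGraph _ δ)
  -- the two trace neighbours of the tips
  have hu' : p.getVert (τ - 1) ∈ C''.support :=
    hKC _ ((hK _).2 (Or.inr ⟨τ - 1, by omega, Or.inl (by omega), rfl⟩))
  have hv' : p.getVert (τ' + 1) ∈ C''.support :=
    hKC _ ((hK _).2 (Or.inr ⟨τ' + 1, by omega, Or.inr (by omega), rfl⟩))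
  have hadj_u : (zdGraph 2).Adj (p.getVert τ) (p.getVert (τ - 1)) := by
    have h := p.adj_getVert_succ (i := τ - 1) (by omega)
    rw [show τ - 1 + 1 = τ by omega] at h
    exact (hzdΩ h).symm
  have hadj_v : (zdGraph 2).Adj (p.getVert τ') (p.getVert (τ' + 1)) :=
    hzdΩ (p.adj_getVert_succ (i := τ') (by omega))
  -- the witness is a chord of the hung carrier
  obtain ⟨-, -, Q, hQ, havoid, hwin⟩ := hwit
  have hQK : ∀ z ∈ Q.support, z ∉ K := by
    intro z hz hzK
    rcases (hK z).1 hzK with hzS | ⟨m, hmL, hm, hmeq⟩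
    · exact (havoid z hz).1 hzS
    · exact (havoid z hz).2 m hmL hm hmeq.symm
  let γ₀ : DomainSAW (dom C'' δ) δ (p.getVert τ) (p.getVert τ') :=
    ⟨Q.transfer _ (edges_mem_edgeSet_keep hadj Q hQK), hQ.transfer _⟩
  have hsupp : γ₀.walk.support = Q.support := SimpleGraph.Walk.support_transfer _ _
  have hγ₀ : ¬ (polyline γ₀).HasTraversals (2 * n₀ + 1 + 1) y ((3 * ρ + R) / 4) ((ρ + 3 * R) / 4) := by
    intro hT
    rw [show 2 * n₀ + 1 + 1 = 2 * (n₀ + 1) by ring] at hT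
    obtain ⟨ι, κ, hικ, hκL, hside, hsep⟩ :=
      ExcursionDomination.ShellIteration.exists_sepIndexTraversals_of_hasTraversals_toCurve hδ.le
        (meshPoint δ) (ExcursionDomination.ShellIteration.dist_meshPoint_le_of_le_zdGraph hzdΩ' hδ.le)
        γ₀.walk hs₁ hs₂ hs₁₂ hT
    have hW : HasSepWindows (meshPoint δ) γ₀.walk (n₀ + 1) 0 γ₀.walk.length y s₁ s₂ :=
      ⟨ι, κ, fun m => ⟨Nat.zero_le _, hικ m, hκL m⟩, hside, hsep⟩
    rw [hasSepWindows_congr (meshPoint δ) (getVert_eq_of_support_eq hsupp), length_eq_of_support_eq hsupp] at hW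
    exact hwin hW
  -- the engine
  have hE := hUST δ c'' (p.getVert τ) (p.getVert τ') (p.getVert (τ - 1)) (p.getVert (τ' + 1)) C'' hδ hu' hv'
    hadj_u hadj_v y ρ R hρ hρR ⟨γ₀, hγ₀⟩
  refine (measure_mono fun β' hβ' => ?_).trans hE
  exact hasTraversals_of_hasSepWindows δ (discreteDomainGraph (dom C'' δ) δ) _ _ β'.walk n y ρ R hβ'

/-- **Registered form of S3** (crux stmt-CriticalPhenomena-1878, line `slit-necklace`, helper of `stub_slotLaw`;
`law_slotMiddle_le` with all binders explicit): in the doubly-slit hung carrier `dom C'' δ` of the middle of a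
far-tip piece (graph = `Ω_δ` restricted to `Keep(p τ', K)`, `K` = spine ∪ prefix ∪ suffix vertices, all on the
trace of `C''`), the engine's conclusion at allowance `2 n₀ + 1` and threshold `n` together with a far-tip witness
of budget `n₀ + 1` across `D(y; s₁, s₂)`, `(3ρ + R)/4 + δ ≤ s₁ < s₂ ≤ (ρ + 3R)/4 - δ`, bound the law of `n`
strictly separated index windows of the middle across `D(y; ρ, R)` by `ε`. [folklore] -/
theorem slot_engine_bound :
    ∀ (Ω : Set ℂ) (δ : ℝ) (a₀ b₀ : Site 2) (Sp K : Set (Site 2)) (p : (discreteDomainGraph Ω δ).Walk a₀ b₀)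
      (τ τ' n n₀ : ℕ) (c'' : Site 2) (C'' : (zdGraph 2).Walk c'' c'') (y : ℂ) (ρ R s₁ s₂ ε : ℝ),
      0 < δ → 1 ≤ τ → τ ≤ τ' → τ' + 1 ≤ p.length →
      (∀ z, z ∈ K ↔ z ∈ Sp ∨ ∃ m, m ≤ p.length ∧ (m < τ ∨ τ' < m) ∧ p.getVert m = z) →
      (∀ z ∈ K, z ∈ C''.support) →
      (∀ x' y', (discreteDomainGraph (dom C'' δ) δ).Adj x' y' ↔
        ((discreteDomainGraph Ω δ).Adj x' y' ∧
          (∃ q : (discreteDomainGraph Ω δ).Walk x' (p.getVert τ'), ∀ v ∈ q.support, v ∉ K) ∧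
          (∃ q : (discreteDomainGraph Ω δ).Walk y' (p.getVert τ'), ∀ v ∈ q.support, v ∉ K))) →
      (∀ (δ : ℝ) (c u v u' v' : Site 2) (C : (zdGraph 2).Walk c c),
        0 < δ → u' ∈ C.support → v' ∈ C.support → (zdGraph 2).Adj u u' → (zdGraph 2).Adj v v' →
        ∀ (x : ℂ) (ρ R : ℝ), δ ≤ ρ → 2 * ρ ≤ R →
          (∃ γ₀ : DomainSAW (dom C δ) δ u v,
            ¬ (polyline γ₀).HasTraversals (2 * n₀ + 1 + 1) x ((3 * ρ + R) / 4) ((ρ + 3 * R) / 4)) →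
          law (dom C δ) δ u v {γ | (polyline γ).HasTraversals n x ρ R} ≤ ENNReal.ofReal ε) →
      δ ≤ ρ → 2 * ρ ≤ R → (3 * ρ + R) / 4 + δ ≤ s₁ → s₁ < s₂ → s₂ ≤ (ρ + 3 * R) / 4 - δ →
      HasFarTipWitness Ω δ Sp p τ τ' (n₀ + 1) y s₁ s₂ →
      law (dom C'' δ) δ (p.getVert τ) (p.getVert τ')
          {β' | HasSepWindows (meshPoint δ) β'.walk n 0 β'.walk.length y ρ R} ≤ ENNReal.ofReal ε :=
  fun _ _ _ _ _ _ _ _ _ _ _ _ _ _ _ _ _ _ _ hδ hτ hττ' hτ'L hK hKC hadj hUST hρ hρR hs₁ hs₁₂ hs₂ hwit =>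
    law_slotMiddle_le hδ hτ hττ' hτ'L hK hKC hadj hUST hρ hρR hs₁ hs₁₂ hs₂ hwit

end Engine

end Summit.CriticalPhenomena.SAWScalingLimit.Theorems.FKGToTraversalBound.SlitNecklace

end
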